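import Summits.AtomisticToContinuum.FouriersLaw.Theorems.BondHeatUncertaintyLinearResponseFTURSchemeConvergence

/-!
# The dyadic splitting schemes converge to the flow, uniformly on `[0, t]` (K3 helper)

Helper file for stub `stub_antiDampedGirsanov` (K3) of line `lebesgue-flip-duality`, crux ★
`BondHeatUncertainty.LinearResponseFTUR` (stmt-AtomisticToContinuum-9122); sequel of
`…SchemeConvergence.lean`: its Grönwall estimate `SchemeData.norm_path_sub_le` becomes a limit theorem
along the dyadic meshes `h_m = t/2^m` (`dyadic`, `tendsto_dyadic_path`): if a continuous `X` solves
`X(s) = y + (ε n(s) - σγ ∫₀ˢ Π(X)) + ∫₀ˢ Y₀(X)` on `[0, t]` for a continuous noise `n`, `n(0) = 0`, with bath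
momenta in `[-R, R]`, and the increments fed to the scheme reproduce those of `n`, then
`∀ η > 0, ∀ᶠ m, ∀ s ∈ [0, t], ‖z_m(s) - X(s)‖ ≤ η`. The moduli `wn`, `wz` are controlled by the modulus of
continuity of `n` (`norm_forcing_sub_le`, `norm_path_sub_path_le`), uniformly in the mesh. Deterministic.
-/

noncomputable section

namespace Summit.AtomisticToContinuum.FouriersLaw.Theorems.LinearResponseFTUR

open MeasureTheory Filter Set Function Finset intervalIntegral Topology Metric
open scoped NNReal
open Literature.MathematicalPhysics.KineticTheory
open Literature.MathematicalPhysics.KineticTheory.HeatConduction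
open Literature.Analysis.ODE

variable {N : ℕ}
/-! ### `stepFrac` bookkeeping: the elapsed fractions partition time -/
/-- `stepFrac h j` is monotone in time. -/
theorem stepFrac_mono (h : ℝ) (j : ℕ) : Monotone (stepFrac h j) := by
  intro s s' hss'
  unfold stepFrac
  exact min_le_min_right _ (max_le_max_right _ (by linarith))
/-- On `[0, M h]` the elapsed fractions add up to the elapsed time. -/
theorem sum_stepFrac_eq {h : ℝ} (hh : 0 < h) {M : ℕ} {s : ℝ} (hs : s ∈ Icc 0 (M * h)) :
    ∑ j ∈ Finset.range M, stepFrac h j s = s := by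
  rcases Nat.eq_zero_or_pos M with rfl | hM
  · simp only [Nat.cast_zero, zero_mul, Set.mem_Icc] at hs
    have hs0 : s = 0 := le_antisymm hs.2 hs.1
    simp [hs0]
  obtain ⟨k, hk, r, hr, rfl⟩ := exists_step_decomp hh hM hs
  simp_rw [stepFrac_grid_add hh _ k hr]
  have hrw : ∀ j ∈ Finset.range M, (if j < k then h else if j = k then r else 0) =
      (if j ∈ Finset.range k then h else 0) + (if j = k then r else 0) := by
    intro j _
    by_cases h1 : j < k
    · simp [h1, h1.ne]
    · by_cases h2 : j = k
      · simp [h2]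
      · simp [h1, h2]
  rw [Finset.sum_congr rfl hrw, Finset.sum_add_distrib, Finset.sum_ite_mem, Finset.sum_ite_eq']
  have hkk : Finset.range M ∩ Finset.range k = Finset.range k := by
    ext j; simp only [Finset.mem_inter, Finset.mem_range]; omega
  rw [hkk, Finset.sum_const, Finset.card_range, nsmul_eq_mul, if_pos (Finset.mem_range.2 hk)]
/-- The total variation of the elapsed fractions between two times of `[0, M h]` is the elapsed time. -/
theorem sum_abs_stepFrac_sub {h : ℝ} (hh : 0 < h) {M : ℕ} {r r' : ℝ} (hr : r ∈ Icc 0 (M * h))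
    (hr' : r' ∈ Icc 0 (M * h)) :
    ∑ j ∈ Finset.range M, |stepFrac h j r - stepFrac h j r'| = |r - r'| := by
  wlog hle : r' ≤ r generalizing r r'
  · simpa only [abs_sub_comm] using this hr' hr (le_of_not_ge hle)
  rw [abs_of_nonneg (sub_nonneg.2 hle)]
  have habs : ∀ j, |stepFrac h j r - stepFrac h j r'| = stepFrac h j r - stepFrac h j r' := fun j =>
    abs_of_nonneg (sub_nonneg.2 (stepFrac_mono h j hle))
  simp_rw [habs, Finset.sum_sub_distrib, sum_stepFrac_eq hh hr, sum_stepFrac_eq hh hr']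
/-- The clamped friction direction has norm at most `2R`. -/
theorem norm_frictionImpulse_le {R : ℝ} (hR : 0 ≤ R) (z : PhaseSpace N) :
    ‖frictionImpulse N R z‖ ≤ 2 * R := by
  unfold frictionImpulse
  refine (norm_add_le _ _).trans ?_
  have h1 := (norm_bathVec_le N 0 _).trans (clampR_le hR (leftMom N z))
  have h2 := (norm_bathVec_le N (N - 1) _).trans (clampR_le hR (rightMom N z))
  linarith

namespace SchemeData

variable (D : SchemeData N) (ε σ : ℝ) (M : ℕ) (y : PhaseSpace N) (x : ℕ → ℝ × ℝ)
/-- The impulse of a step is bounded by `|ε|·‖noise impulse‖ + |σγh|·2R`. -/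
theorem norm_impulse_le (hR : 0 ≤ D.R) (z : PhaseSpace N) (v : ℝ × ℝ) :
    ‖D.impulse ε σ z v‖ ≤ |ε| * ‖noiseImpulse N D.cL D.cR v‖ + |σ * D.γ * D.h| * (2 * D.R) := by
  unfold impulse
  refine (norm_sub_le _ _).trans (add_le_add ?_ ?_)
  · rw [norm_smul, Real.norm_eq_abs]
  · rw [norm_smul, Real.norm_eq_abs]
    exact mul_le_mul_of_nonneg_left (norm_frictionImpulse_le hR z) (abs_nonneg _)

/-- **The forcing is piecewise linear with the impulses as increments**: over a time lag `≤ h` inside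
`[0, M h]` it moves by at most the largest impulse. -/
theorem norm_forcing_sub_le (hh : 0 < D.h) {U : ℝ} (hU0 : 0 ≤ U)
    (hU : ∀ j, j < M → ‖D.impulse ε σ (D.state ε σ y x j) (x j)‖ ≤ U)
    {r r' : ℝ} (hr : r ∈ Icc 0 (M * D.h)) (hr' : r' ∈ Icc 0 (M * D.h)) (hrr' : |r - r'| ≤ D.h) :
    ‖D.forcing ε σ M y x r - D.forcing ε σ M y x r'‖ ≤ U := by
  unfold forcing
  rw [← Finset.sum_sub_distrib]
  have hterm : ∀ j ∈ Finset.range M,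
      (stepFrac D.h j r / D.h) • D.impulse ε σ (D.state ε σ y x j) (x j) -
          (stepFrac D.h j r' / D.h) • D.impulse ε σ (D.state ε σ y x j) (x j) =
        ((stepFrac D.h j r - stepFrac D.h j r') / D.h) • D.impulse ε σ (D.state ε σ y x j) (x j) := by
    intro j _
    rw [← sub_smul, sub_div]
  rw [Finset.sum_congr rfl hterm]
  calc ‖∑ j ∈ Finset.range M, ((stepFrac D.h j r - stepFrac D.h j r') / D.h) •
          D.impulse ε σ (D.state ε σ y x j) (x j)‖
      ≤ ∑ j ∈ Finset.range M, |stepFrac D.h j r - stepFrac D.h j r'| / D.h * U := by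
        refine norm_sum_le_of_le _ fun j hj => ?_
        rw [norm_smul, Real.norm_eq_abs, abs_div, abs_of_pos hh]
        exact mul_le_mul_of_nonneg_left (hU j (Finset.mem_range.1 hj)) (by positivity)
    _ = |r - r'| / D.h * U := by
        rw [← Finset.sum_mul, ← Finset.sum_div, sum_abs_stepFrac_sub hh hr hr']
    _ ≤ 1 * U := by
        refine mul_le_mul_of_nonneg_right ?_ hU0
        rwa [div_le_one hh]
    _ = U := one_mul U

variable {D ε σ M y x}
variable (D₀ : ConfinedDrift D.Y₀) (hD₀ : D₀.noise = momentumSubspace N)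
include D₀ hD₀

/-- **Modulus of continuity of the scheme path over one mesh**: if the impulses are bounded by `U`
and the drift along the path by `C` on `[0, M h]`, then `‖z(r) - z(r')‖ ≤ U + h C` for `|r - r'| ≤ h`. -/
theorem norm_path_sub_path_le (hh : 0 < D.h) {U : ℝ} (hU0 : 0 ≤ U)
    (hU : ∀ j, j < M → ‖D.impulse ε σ (D.state ε σ y x j) (x j)‖ ≤ U) {C : ℝ}
    (hC : ∀ s ∈ Icc 0 (M * D.h), ‖D.Y₀ (D.path ε σ M y x s)‖ ≤ C)
    {r r' : ℝ} (hr : r ∈ Icc 0 (M * D.h)) (hr' : r' ∈ Icc 0 (M * D.h)) (hrr' : |r - r'| ≤ D.h) :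
    ‖D.path ε σ M y x r - D.path ε σ M y x r'‖ ≤ U + D.h * C := by
  have hcont : Continuous fun u => D.Y₀ (D.path ε σ M y x u) :=
    D₀.contDiff_drift.continuous.comp (continuous_path D₀ hD₀)
  have heq := path_eq_integral (ε := ε) (σ := σ) (M := M) (y := y) (x := x) D₀ hD₀ (T := M * D.h)
  have hdiff : D.path ε σ M y x r - D.path ε σ M y x r' =
      (D.forcing ε σ M y x r - D.forcing ε σ M y x r') +
        ∫ u in r'..r, D.Y₀ (D.path ε σ M y x u) := by
    rw [heq r hr, heq r' hr',
      ← integral_add_adjacent_intervals (hcont.intervalIntegrable 0 r') (hcont.intervalIntegrable r' r)]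
    abel
  rw [hdiff]
  refine (norm_add_le _ _).trans (add_le_add (norm_forcing_sub_le D ε σ M y x hh hU0 hU hr hr' hrr') ?_)
  have hC0 : 0 ≤ C := (norm_nonneg _).trans (hC 0 ⟨le_rfl, hr.1.trans hr.2⟩)
  have hbound : ∀ u ∈ Set.uIoc r' r, ‖D.Y₀ (D.path ε σ M y x u)‖ ≤ C := by
    intro u hu
    refine hC u ⟨?_, ?_⟩
    · rcases le_total r' r with h | h
      · rw [uIoc_of_le h] at hu; exact hr'.1.trans hu.1.le
      · rw [uIoc_of_ge h] at hu; exact hr.1.trans hu.1.le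
    · rcases le_total r' r with h | h
      · rw [uIoc_of_le h] at hu; exact hu.2.trans hr.2
      · rw [uIoc_of_ge h] at hu; exact hu.2.trans hr'.2
  calc ‖∫ u in r'..r, D.Y₀ (D.path ε σ M y x u)‖ ≤ C * |r - r'| :=
        intervalIntegral.norm_integral_le_of_norm_le_const hbound
    _ ≤ C * D.h := mul_le_mul_of_nonneg_left hrr' hC0
    _ = D.h * C := mul_comm _ _

end SchemeData
/-! ### The dyadic schemes and their convergence -/
/-- The splitting scheme of mesh `t / 2^m` (frictionless drift `Y₀`, friction `γ`, clamp level `R`,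
noise amplitudes `cL, cR`). -/
def dyadic (Y₀ : PhaseSpace N → PhaseSpace N) (γ R cL cR t : ℝ) (m : ℕ) : SchemeData N :=
  ⟨Y₀, γ, t / 2 ^ m, R, cL, cR⟩

/-- The dyadic mesh closes up: `2^m · (t/2^m) = t` (with the natural-number cast of the scheme). -/
theorem cast_two_pow_mul_div (t : ℝ) (m : ℕ) : ((2 ^ m : ℕ) : ℝ) * (t / 2 ^ m) = t := by
  push_cast
  exact mul_div_cancel₀ _ (pow_ne_zero _ two_ne_zero)

/-- The dyadic mesh tends to zero. -/
theorem tendsto_mesh (t : ℝ) : Tendsto (fun m : ℕ => t / 2 ^ m) atTop (𝓝 0) :=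
  tendsto_const_nhds.div_atTop (tendsto_pow_atTop_atTop_of_one_lt one_lt_two)

/-- **The dyadic splitting schemes converge to the flow, uniformly on `[0, t]`** (see the module
docstring). -/
theorem tendsto_dyadic_path {Y₀ : PhaseSpace N → PhaseSpace N} (D₀ : ConfinedDrift Y₀)
    (hD₀ : D₀.noise = momentumSubspace N) {t γ R cL cR : ℝ} (ht : 0 < t) (hR : 0 ≤ R) (ε σ : ℝ)
    {n : ℝ → PhaseSpace N} (hn : Continuous n) (hn0 : n 0 = 0) (xs : ℕ → ℕ → ℝ × ℝ)
    (hxs : ∀ m k : ℕ, k < 2 ^ m → noiseImpulse N cL cR (xs m k) =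
      n (((k : ℝ) + 1) * (t / 2 ^ m)) - n ((k : ℝ) * (t / 2 ^ m)))
    {X : ℝ → PhaseSpace N} (hXc : Continuous X) (y : PhaseSpace N)
    (hXeq : ∀ s ∈ Icc 0 t, X s = y + (ε • n s - (σ * γ) • ∫ u in (0 : ℝ)..s, frictionVec N (X u)) +
      ∫ u in (0 : ℝ)..s, Y₀ (X u))
    (hXR : ∀ s ∈ Icc 0 t, |leftMom N (X s)| ≤ R ∧ |rightMom N (X s)| ≤ R) :
    ∀ η : ℝ, 0 < η → ∀ᶠ m : ℕ in atTop, ∀ s ∈ Icc 0 t,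
      ‖(dyadic Y₀ γ R cL cR t m).path ε σ (2 ^ m) y (xs m) s - X s‖ ≤ η := by
  intro η hη
  -- mesh-independent bounds
  obtain ⟨A, hA⟩ := isCompact_Icc.exists_bound_of_continuousOn (hn.continuousOn (s := Icc 0 t))
  have hA0 : 0 ≤ A := (norm_nonneg _).trans (hA 0 ⟨le_rfl, ht.le⟩)
  obtain ⟨ρX, hρX⟩ := isCompact_Icc.exists_bound_of_continuousOn (hXc.continuousOn (s := Icc 0 t))
  set Mf : ℝ := |ε| * A + |σ * γ| * t * (2 * R) with hMf
  set ρ : ℝ := max (D₀.apriori (D₀.V y) Mf t) ρX with hρ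
  obtain ⟨L, hL⟩ := exists_lipschitzOnWith_closedBall D₀.contDiff_drift ρ
  obtain ⟨C, hC⟩ := (isCompact_closedBall (0 : PhaseSpace N) ρ).exists_bound_of_continuousOn
    (D₀.contDiff_drift.continuous.continuousOn)
  have hC0 : 0 ≤ C := (norm_nonneg _).trans (hC 0 (mem_closedBall_self ((norm_nonneg _).trans
    ((hρX 0 ⟨le_rfl, ht.le⟩).trans (le_max_right _ _)))))
  -- the target accuracy for the two moduli
  set E : ℝ := Real.exp (((L : ℝ) + 2 * |σ * γ|) * t) with hE
  have hE0 : 0 < E := Real.exp_pos _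
  set θ : ℝ := η / ((|ε| + 2 * t * |σ * γ| + 1) * E) with hθ
  have hden : 0 < (|ε| + 2 * t * |σ * γ| + 1) * E := by positivity
  have hθ0 : 0 < θ := div_pos hη hden
  have hθη : (|ε| * θ + |σ * γ| * (2 * t * θ)) * E ≤ η := by
    have : (|ε| * θ + |σ * γ| * (2 * t * θ)) * E = θ * ((|ε| + 2 * t * |σ * γ|) * E) := by ring
    rw [this, hθ, div_mul_eq_mul_div, div_le_iff₀ hden]
    have h1 : 0 ≤ η * E := by positivity
    nlinarith [abs_nonneg ε, abs_nonneg (σ * γ), h1, ht.le]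
  set θ' : ℝ := θ / (2 * (|ε| + 1)) with hθ'
  have hθ'0 : 0 < θ' := by positivity
  have hεθ' : |ε| * θ' ≤ θ / 2 := by
    rw [hθ', mul_div_assoc']
    rw [div_le_iff₀ (by positivity), ]
    nlinarith [abs_nonneg ε, hθ0.le]
  have hθ'θ : θ' ≤ θ := by
    rw [hθ', div_le_iff₀ (by positivity)]
    nlinarith [abs_nonneg ε, hθ0.le]
  -- uniform continuity of `n` on `[0, t]`
  obtain ⟨δ, hδ0, hδ⟩ : ∃ δ > 0, ∀ s ∈ Icc 0 t, ∀ s' ∈ Icc 0 t, |s - s'| ≤ δ → ‖n s - n s'‖ ≤ θ' := by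
    have huc := isCompact_Icc.uniformContinuousOn_of_continuous (hn.continuousOn (s := Icc 0 t))
    rw [Metric.uniformContinuousOn_iff_le] at huc
    obtain ⟨δ, hδ0, hδ⟩ := huc θ' hθ'0
    refine ⟨δ / 2, by positivity, fun s hs s' hs' hss' => ?_⟩
    have := hδ s hs s' hs' (by rw [Real.dist_eq]; linarith)
    rwa [dist_eq_norm] at this
  -- eventually the mesh is below `δ` and `h (2|σγ|R + C) ≤ θ/2`
  have hev1 : ∀ᶠ m : ℕ in atTop, t / 2 ^ m ≤ δ :=
    (tendsto_mesh t).eventually (eventually_le_nhds hδ0)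
  have hev2 : ∀ᶠ m : ℕ in atTop, t / 2 ^ m * (|σ * γ| * (2 * R) + C) ≤ θ / 2 := by
    have h := (tendsto_mesh t).mul_const (|σ * γ| * (2 * R) + C)
    rw [zero_mul] at h
    exact h.eventually (eventually_le_nhds (by positivity))
  filter_upwards [hev1, hev2] with m hm1 hm2
  -- notation for mesh `m`
  set D : SchemeData N := dyadic Y₀ γ R cL cR t m with hDdef
  have hDh : D.h = t / 2 ^ m := rfl
  have hDγ : D.γ = γ := rfl
  have hDR : D.R = R := rfl
  have hDL : D.cL = cL := rfl
  have hDRR : D.cR = cR := rfl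
  have hDY : D.Y₀ = Y₀ := rfl
  have hh : 0 < D.h := by rw [hDh]; positivity
  have hM : 0 < 2 ^ m := pow_pos two_pos m
  have hMh : ((2 ^ m : ℕ) : ℝ) * D.h = t := by rw [hDh]; exact cast_two_pow_mul_div t m
  -- the partial sums of the noise impulses are the values of `n` at the nodes
  have hpartial : ∀ k : ℕ, k ≤ 2 ^ m →
      ∑ j ∈ Finset.range k, noiseImpulse N D.cL D.cR (xs m j) = n ((k : ℝ) * (t / 2 ^ m)) := by
    intro k hk
    have hsum := Finset.sum_range_sub (fun j : ℕ => n ((j : ℝ) * (t / 2 ^ m))) k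
    simp only [Nat.cast_zero, zero_mul, hn0, sub_zero] at hsum
    rw [← hsum]
    refine Finset.sum_congr rfl fun j hj => ?_
    rw [hDL, hDRR, hxs m j (lt_of_lt_of_le (Finset.mem_range.1 hj) hk)]
    push_cast
    ring_nf
  have hnode_mem : ∀ k : ℕ, k ≤ 2 ^ m → (k : ℝ) * (t / 2 ^ m) ∈ Icc 0 t := by
    intro k hk
    refine ⟨by positivity, ?_⟩
    have : (k : ℝ) ≤ 2 ^ m := by exact_mod_cast hk
    calc (k : ℝ) * (t / 2 ^ m) ≤ 2 ^ m * (t / 2 ^ m) := mul_le_mul_of_nonneg_right this (by positivity)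
      _ = t := mul_div_cancel₀ _ (pow_ne_zero _ two_ne_zero)
  have hAk : ∀ k, k ≤ 2 ^ m → ‖∑ j ∈ Finset.range k, noiseImpulse N D.cL D.cR (xs m j)‖ ≤ A := by
    intro k hk
    rw [hpartial k hk]
    exact hA _ (hnode_mem k hk)
  -- forcing and path bounds, uniform in `m`
  have hF : ∀ s ∈ Icc 0 t, ‖D.forcing ε σ (2 ^ m) y (xs m) s‖ ≤ Mf := by
    intro s _
    have h := SchemeData.norm_forcing_le (D := D) (ε := ε) (σ := σ) (M := 2 ^ m) (y := y) (x := xs m) hh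
      (by rw [hDR]; exact hR) hAk s
    rw [hMh, hDγ, hDR] at h
    simpa only [hMf, mul_assoc] using h
  have hzS : ∀ s ∈ Icc 0 t, D.path ε σ (2 ^ m) y (xs m) s ∈ closedBall (0 : PhaseSpace N) ρ := by
    intro s hs
    rw [mem_closedBall, dist_zero_right]
    exact (SchemeData.norm_path_le D₀ hD₀ hF s hs).trans (le_max_left _ _)
  have hXS : ∀ s ∈ Icc 0 t, X s ∈ closedBall (0 : PhaseSpace N) ρ := by
    intro s hs
    rw [mem_closedBall, dist_zero_right]
    exact (hρX s hs).trans (le_max_right _ _)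
  -- the impulse bound `U` and the two moduli
  have hincr : ∀ j, j < 2 ^ m → ‖noiseImpulse N D.cL D.cR (xs m j)‖ ≤ θ' := by
    intro j hj
    rw [hDL, hDRR, hxs m j hj, ← norm_neg, neg_sub]
    refine hδ _ (hnode_mem j hj.le) _ ?_ ?_
    · have := hnode_mem (j + 1) hj
      push_cast at this
      exact this
    · rw [show (j : ℝ) * (t / 2 ^ m) - ((j : ℝ) + 1) * (t / 2 ^ m) = -(t / 2 ^ m) by ring, abs_neg,
        abs_of_pos (by positivity)]
      exact hm1
  set U : ℝ := |ε| * θ' + |σ * γ * D.h| * (2 * R) with hU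
  have hU0 : 0 ≤ U := by positivity
  have hUj : ∀ j, j < 2 ^ m → ‖D.impulse ε σ (D.state ε σ y (xs m) j) (xs m j)‖ ≤ U := by
    intro j hj
    refine (D.norm_impulse_le ε σ (by rw [hDR]; exact hR) _ _).trans ?_
    rw [hDγ, hDR]
    exact add_le_add (mul_le_mul_of_nonneg_left (hincr j hj) (abs_nonneg _)) le_rfl
  have hCz : ∀ s ∈ Icc 0 (((2 ^ m : ℕ) : ℝ) * D.h), ‖D.Y₀ (D.path ε σ (2 ^ m) y (xs m) s)‖ ≤ C := by
    intro s hs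
    rw [hMh] at hs
    exact hC _ (hzS s hs)
  -- `wz`
  have hwz : ∀ r ∈ Icc 0 (((2 ^ m : ℕ) : ℝ) * D.h), ∀ r' ∈ Icc 0 (((2 ^ m : ℕ) : ℝ) * D.h),
      |r - r'| ≤ D.h → ‖D.path ε σ (2 ^ m) y (xs m) r - D.path ε σ (2 ^ m) y (xs m) r'‖ ≤ θ := by
    intro r hr r' hr' hrr'
    refine (SchemeData.norm_path_sub_path_le D₀ hD₀ hh hU0 hUj hCz hr hr' hrr').trans ?_
    rw [hU, hDh]
    have h1 : |σ * γ * (t / 2 ^ m)| * (2 * R) = t / 2 ^ m * (|σ * γ| * (2 * R)) := by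
      rw [abs_mul, abs_of_pos (show (0 : ℝ) < t / 2 ^ m by positivity)]; ring
    rw [h1]
    nlinarith [hεθ', hm2]
  -- `wn`
  have hwn : ∀ s ∈ Icc 0 (((2 ^ m : ℕ) : ℝ) * D.h),
      ‖(∑ j ∈ Finset.range (2 ^ m), (stepFrac D.h j s / D.h) • noiseImpulse N D.cL D.cR (xs m j)) -
        n s‖ ≤ θ := by
    intro s hs
    obtain ⟨k, hk, r, hr, hsr⟩ := exists_step_decomp hh hM hs
    -- the interpolant is the convex combination of `n(kh)` and `n((k+1)h)`
    have hval : ∑ j ∈ Finset.range (2 ^ m), (stepFrac D.h j s / D.h) • noiseImpulse N D.cL D.cR (xs m j) =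
        (1 - r / D.h) • n ((k : ℝ) * (t / 2 ^ m)) + (r / D.h) • n (((k : ℝ) + 1) * (t / 2 ^ m)) := by
      rw [hsr]
      simp_rw [stepFrac_grid_add hh _ k hr]
      have hrw : ∀ j ∈ Finset.range (2 ^ m),
          ((if j < k then D.h else if j = k then r else 0) / D.h) • noiseImpulse N D.cL D.cR (xs m j) =
            (if j ∈ Finset.range k then noiseImpulse N D.cL D.cR (xs m j) else 0) +
              (if j = k then (r / D.h) • noiseImpulse N D.cL D.cR (xs m j) else 0) := by
        intro j _
        by_cases h1 : j < k
        · simp [h1, h1.ne, div_self hh.ne']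
        · by_cases h2 : j = k
          · simp [h2]
          · simp [h1, h2]
      rw [Finset.sum_congr rfl hrw, Finset.sum_add_distrib, Finset.sum_ite_mem, Finset.sum_ite_eq',
        if_pos (Finset.mem_range.2 hk)]
      have hkk : Finset.range (2 ^ m) ∩ Finset.range k = Finset.range k := by
        ext j; simp only [Finset.mem_inter, Finset.mem_range]; omega
      rw [hkk, hpartial k hk.le, hDL, hDRR, hxs m k hk]
      have hk1 := hpartial (k + 1) hk
      simp only [sub_smul, one_smul, smul_sub]
      abel
    rw [hval]
    have hs' : s ∈ Icc 0 t := by rwa [hMh] at hs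
    have hkh := hnode_mem k hk.le
    have hk1h : ((k : ℝ) + 1) * (t / 2 ^ m) ∈ Icc 0 t := by
      have := hnode_mem (k + 1) hk; push_cast at this; exact this
    have hr' : 0 ≤ r / D.h ∧ r / D.h ≤ 1 :=
      ⟨div_nonneg hr.1 hh.le, (div_le_one hh).2 hr.2⟩
    have hd1 : ‖n ((k : ℝ) * (t / 2 ^ m)) - n s‖ ≤ θ' := by
      refine hδ _ hkh _ hs' ?_
      rw [hsr, hDh, show (k : ℝ) * (t / 2 ^ m) - ((k : ℝ) * (t / 2 ^ m) + r) = -r by ring, abs_neg,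
        abs_of_nonneg hr.1]
      exact hr.2.trans (hDh ▸ hm1)
    have hd2 : ‖n (((k : ℝ) + 1) * (t / 2 ^ m)) - n s‖ ≤ θ' := by
      refine hδ _ hk1h _ hs' ?_
      rw [hsr, hDh, show ((k : ℝ) + 1) * (t / 2 ^ m) - ((k : ℝ) * (t / 2 ^ m) + r) = t / 2 ^ m - r by ring,
        abs_of_nonneg (by rw [hDh] at hr; linarith [hr.2])]
      have : 0 ≤ r := hr.1
      linarith [hm1]
    have hsplit : (1 - r / D.h) • n ((k : ℝ) * (t / 2 ^ m)) + (r / D.h) • n (((k : ℝ) + 1) * (t / 2 ^ m)) - n s =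
        (1 - r / D.h) • (n ((k : ℝ) * (t / 2 ^ m)) - n s) +
          (r / D.h) • (n (((k : ℝ) + 1) * (t / 2 ^ m)) - n s) := by
      simp only [smul_sub, sub_smul, one_smul]; abel
    rw [hsplit]
    calc ‖(1 - r / D.h) • (n ((k : ℝ) * (t / 2 ^ m)) - n s) +
            (r / D.h) • (n (((k : ℝ) + 1) * (t / 2 ^ m)) - n s)‖
        ≤ (1 - r / D.h) * θ' + (r / D.h) * θ' := by
          refine (norm_add_le _ _).trans (add_le_add ?_ ?_)
          · rw [norm_smul, Real.norm_eq_abs, abs_of_nonneg (by linarith [hr'.2])]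
            exact mul_le_mul_of_nonneg_left hd1 (by linarith [hr'.2])
          · rw [norm_smul, Real.norm_eq_abs, abs_of_nonneg hr'.1]
            exact mul_le_mul_of_nonneg_left hd2 hr'.1
      _ = θ' := by ring
      _ ≤ θ := hθ'θ
  -- the hypotheses of the Grönwall estimate on `[0, 2^m h] = [0, t]`
  have hXeq' : ∀ s ∈ Icc 0 (((2 ^ m : ℕ) : ℝ) * D.h), X s =
      y + (ε • n s - (σ * D.γ) • ∫ u in (0 : ℝ)..s, frictionVec N (X u)) + ∫ u in (0 : ℝ)..s, D.Y₀ (X u) := by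
    intro s hs; rw [hMh] at hs; rw [hDγ, hDY]; exact hXeq s hs
  have hXR' : ∀ s ∈ Icc 0 (((2 ^ m : ℕ) : ℝ) * D.h), |leftMom N (X s)| ≤ D.R ∧ |rightMom N (X s)| ≤ D.R := by
    intro s hs; rw [hMh] at hs; rw [hDR]; exact hXR s hs
  have hXS' : ∀ s ∈ Icc 0 (((2 ^ m : ℕ) : ℝ) * D.h), X s ∈ closedBall (0 : PhaseSpace N) ρ := by
    intro s hs; rw [hMh] at hs; exact hXS s hs
  have hzS' : ∀ s ∈ Icc 0 (((2 ^ m : ℕ) : ℝ) * D.h), D.path ε σ (2 ^ m) y (xs m) s ∈ closedBall (0 : PhaseSpace N) ρ := by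
    intro s hs; rw [hMh] at hs; exact hzS s hs
  have hL' : LipschitzOnWith L D.Y₀ (closedBall (0 : PhaseSpace N) ρ) := by rw [hDY]; exact hL
  have hmain := SchemeData.norm_path_sub_le D₀ hD₀ hh hM hXc hXeq' hXR' hL' hXS' hzS' hwn hwz
  intro s hs
  have hs' : s ∈ Icc 0 (((2 ^ m : ℕ) : ℝ) * D.h) := by rwa [hMh]
  refine (hmain s hs').trans ?_
  rw [hMh, hDγ]
  have hexp : Real.exp (((L : ℝ) + 2 * |σ * γ|) * s) ≤ E := by
    rw [hE]
    exact Real.exp_le_exp.2 (mul_le_mul_of_nonneg_left hs.2 (by positivity))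
  have hpre : 0 ≤ |ε| * θ + |σ * γ| * (2 * t * θ) := by positivity
  calc (|ε| * θ + |σ * γ| * (2 * t * θ)) * Real.exp (((L : ℝ) + 2 * |σ * γ|) * s)
      ≤ (|ε| * θ + |σ * γ| * (2 * t * θ)) * E := mul_le_mul_of_nonneg_left hexp hpre
    _ ≤ η := hθη

/-- **The elapsed fractions of the steps partition time** — `∀`-form registered as a sub-goal of the crux item. -/
theorem sum_stepFrac_total :
    ∀ (h : ℝ), 0 < h → ∀ (M : ℕ) (s : ℝ), s ∈ Set.Icc 0 ((M : ℝ) * h) → ∑ j ∈ Finset.range M, stepFrac h j s = s :=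
  fun _ hh _ _ hs => sum_stepFrac_eq hh hs

end Summit.AtomisticToContinuum.FouriersLaw.Theorems.LinearResponseFTUR

end
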